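import Summits.Ventures.CertifiedManyBodySolver.Downfold.EmeryBoxesHg1201LRFBThermalCapWord
import Summits.Ventures.CertifiedManyBodySolver.Downfold.EmeryThermalCapRetiltBoxp1
import Literature.MathematicalPhysics.QuantumLattice.EmeryThreeBandThermalMarkovCap
import HarnessLib

/-!
# RE-TILTED and ENTROPY-RESOLVED `T > 0` CAP WORDS on `emeryBoxHg1201LRFB` (level εp = -99/10): the four kgp1x5 corner sector tables read SECTOR-WISE at the common level
# tighten hubbard-downfold-mod-4's cap word `48.8973·β + 6 log 2 → 44.4973·β + 6 log 2` (re-tilt) `→ maxᵢ log Fᵢ(β)` (Markov; `44.4973·β + log 15 = 44.4973·β + 2.7081` as β → ∞); hubbard-box-p1 g23, by value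

Venture CertifiedManyBodySolver, cell `pub/hubbard-downfold` (S1 = ROUTER) × crew hubbard-fast S2 (ii) × (iv) «T > 0 × multi-band» (D-0096 (ii)); seat hubbard-box-p1
(row «Lipschitz / joint laws in (U, μ) of certified objects; box ⊂ ∪ cells ⇒ word»), by value for the word owner hubbard-downfold-mod-4 (COVERAGE BATCH 3 cap words).
Namespace `Summit.Ventures.CertifiedManyBodySolver.Downfold`. Same constructions as `EmeryBoxes<X>ThermalCapRetiltBoxp1` (g21, ask «RE-TILT law» hubbard-fast INBOX
2026-08-28T18:54:56Z (a)) and `EmeryBoxes<X>ThermalMarkovCapBoxp1` (g22) for the batch-1/2 boxes, merged into one file.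

INPUTS BY NAME: `EmeryBoxesHg1201LRFBThermalCapWord` (cap word `emeryBoxHg1201LRFB_pressureCap_m99o10` at εp = -99/10 by MONOTONE level transfer of the four corner certificates `hg1201LRFBFloor_hq_lowerCorner`,
tilts `μ = (-99/10, -52/5, -21/2, -11)`, `q₀ = (-848201/10000, -45451/500, -3668773/40000, -312943/3200)`); `EmeryBoxesHg1201LRFBFloorWord` (table identities `hg1201LRFBFloor_tau/ups/nu i`); the kgp1x5 sector tables
`kgp1x5_<c>_table` / `_sigma` (Hg1201LRFBx_c0_ll_mum99o10, Hg1201LRFBx_c1_hl_mum104o10, Hg1201LRFBx_c2_lh_mum105o10, Hg1201LRFBx_c3_hh_mum110o10; device hubbard-box-p2, batch 3 run by hubbard-downfold-mod-4); the Literature laws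
`EmeryThreeBandCuO4CertificateRetilt` (`posSemidef_cuO4_uniform_retilt_of_sectorFloors`, `sectorFloors_plusGP_retilt`: at M = 2 the shift of sector `k` under `θ ↦ θ + c·ε`
is `≥ max(c·k + min(0, 2c), 2c·k − 4·max(0, 2c))`, `cᵢ = εp − μᵢ = (0, 1/2, 3/5, 11/10)`) and `EmeryThreeBandThermalMarkovCap`
(`emeryCellPressure_le_log_of_gpSectorFloors`: `P_cell ≤ log max_{n≤4} Σ_{j≤6} C(6,j)·e^{−(β/2)·q(j+n)}` from sector floors `q` of the plus); the box doors
`holdsOn_emeryCellPressureCap_of_tiltedCuO4Certificates` (`EmeryThermalBandSeam`) and `holdsOn_emeryCellPressureCap_of_cornerCaps` (`EmeryThermalSeam`).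

RE-TILTED CONSTANTS at εp = -99/10 (exact; binding sector in brackets): q₀′ = (-848201/10000 [k = 8, c = 0], -43451/500 [k = 8, c = 1/2], -3476773/40000 [k = 8, c = 3/5], -284783/3200 [k = 8, c = 11/10]);
slopes `−q₀′/2 = (42.4100, 43.4510, 43.4597, 44.4973)` ⇒ **flat box cap constant `284783/6400 = 44.4973437`** (corner 3 binds) versus `312943/6400 = 48.8973437` of record; the cap word states no same-level floor family for this object, so no T > 0 window is stated here either (the T = 0 floor word is).
ENTROPY-RESOLVED WORD BY VALUE [float, 4 dp, `gen-g24/gen_retilt_markov_box.py`; exact rationals inside the theorems]: flat re-tilted `44.4973·β + 6 log 2` vs Markov `maxᵢ log Fᵢ(β)`: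
| β (1/eV) | flat re-tilted | Markov | gain (nats/CuO₂) |
|---|---|---|---|
| 0.05 | 6.3838 | 6.2308 | 0.1530 |
| 0.1 | 8.6086 | 8.3215 | 0.2871 |
| 0.5 | 26.4076 | 25.4746 | 0.9329 |
| 1 | 48.6562 | 47.4165 | 1.2397 |
| 5 | 226.6456 | 225.1962 | 1.4494 |
| 10 | 449.1323 | 447.6815 | 1.4508 |
| 40 | 1784.0526 | 1782.6018 | 1.4508 |
As β → ∞: `maxᵢ log Fᵢ(β) = 44.4973·β + log 15 + o(1)` (corner 3, re-tilted minimum in sector(s) k = [8], shield offset n = 4); asymptotic gain `6 log 2 − log 15 = 1.4508`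
(the finite-β gains above are smaller whenever a corner's next sector lies close to its minimum). HONEST FRAMING: CERTIFIED inequalities on a SCREENING-GRADE object (U-slice /
companion per EMERY-LINE; box ends [float]/DFT with locators in the router's BOXES files); the re-tilt moves the β-SLOPE of the cap, the Markov reading moves only the CONSTANT
(of the `6 log 2 = 4.1589`); the cap−floor slope mismatch of the T = 0 words is unchanged — thermal scales are NOT resolved; grand-canonical statements at a stated level;
no phase word; no router number moves. WHAT-THIS-IS-NOT: a certificate or a number of record — a reading of existing kernel tables through two laws (zero kit).
-/

noncomputable section

namespace Summit.Ventures.CertifiedManyBodySolver.Downfold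

open NonemptyInterval Matrix Finset Literature.Probability.LatticeModels
open Literature.MathematicalPhysics.QuantumLattice Literature.Computation.Certificates
open Summit.Ventures.CertifiedManyBodySolver.Certificates OccupationCode ClusterLowerBound
open scoped BigOperators ComplexOrder

/-- Each Markov sum is positive (its `j = 0` term is an exponential). [folklore] -/
private theorem sum_choose_exp_pos' (g : ℕ → ℝ) : 0 < ∑ j ∈ Finset.range 7, ((Nat.choose 6 j : ℕ) : ℝ) * Real.exp (g j) :=
  lt_of_lt_of_le (mul_pos (by norm_num) (Real.exp_pos (g 0)))
    (Finset.single_le_sum (f := fun j => ((Nat.choose 6 j : ℕ) : ℝ) * Real.exp (g j)) (fun j _ => by positivity)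
      (Finset.mem_range.2 (by norm_num)))

/-! ## §1 The four sector tables in dictionary form -/

/-- **Sector table, corner 0** (tilt `μ = -99/10`): the kernel table `kgp1x5_Hg1201LRFBx_c0_ll_mum99o10_table` in dictionary form, `θ = emeryLine cuprateSigns (hg1201LRFBCorner 0) + (-99/10)·levelDir`.
[cite: KullEtAl2024, §5.3] -/
theorem hg1201LRFBFloor_table0 : ∀ k ≤ 10, ((kgp1x5_Hg1201LRFBx_c0_ll_mum99o10_sigma k : ℚ) : ℝ) ≤
    groundEnergy (hubbardOpenBoxGP 1 5 (plusTau (emeryLine cuprateSigns (hg1201LRFBCorner 0) + (-99/10 : ℝ) • levelDir) 2)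
      (plusUps (emeryLine cuprateSigns (hg1201LRFBCorner 0) + (-99/10 : ℝ) • levelDir) 2)
      (plusNu (emeryLine cuprateSigns (hg1201LRFBCorner 0) + (-99/10 : ℝ) • levelDir) 2)) k := by
  intro k hk
  have h := kgp1x5_Hg1201LRFBx_c0_ll_mum99o10_table k hk
  rw [hg1201LRFBFloor_tau0, hg1201LRFBFloor_ups0, hg1201LRFBFloor_nu0] at h
  exact h

/-- **Sector table, corner 1** (tilt `μ = -52/5`): the kernel table `kgp1x5_Hg1201LRFBx_c1_hl_mum104o10_table` in dictionary form, `θ = emeryLine cuprateSigns (hg1201LRFBCorner 1) + (-52/5)·levelDir`.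
[cite: KullEtAl2024, §5.3] -/
theorem hg1201LRFBFloor_table1 : ∀ k ≤ 10, ((kgp1x5_Hg1201LRFBx_c1_hl_mum104o10_sigma k : ℚ) : ℝ) ≤
    groundEnergy (hubbardOpenBoxGP 1 5 (plusTau (emeryLine cuprateSigns (hg1201LRFBCorner 1) + (-52/5 : ℝ) • levelDir) 2)
      (plusUps (emeryLine cuprateSigns (hg1201LRFBCorner 1) + (-52/5 : ℝ) • levelDir) 2)
      (plusNu (emeryLine cuprateSigns (hg1201LRFBCorner 1) + (-52/5 : ℝ) • levelDir) 2)) k := by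
  intro k hk
  have h := kgp1x5_Hg1201LRFBx_c1_hl_mum104o10_table k hk
  rw [hg1201LRFBFloor_tau1, hg1201LRFBFloor_ups1, hg1201LRFBFloor_nu1] at h
  exact h

/-- **Sector table, corner 2** (tilt `μ = -21/2`): the kernel table `kgp1x5_Hg1201LRFBx_c2_lh_mum105o10_table` in dictionary form, `θ = emeryLine cuprateSigns (hg1201LRFBCorner 2) + (-21/2)·levelDir`.
[cite: KullEtAl2024, §5.3] -/
theorem hg1201LRFBFloor_table2 : ∀ k ≤ 10, ((kgp1x5_Hg1201LRFBx_c2_lh_mum105o10_sigma k : ℚ) : ℝ) ≤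
    groundEnergy (hubbardOpenBoxGP 1 5 (plusTau (emeryLine cuprateSigns (hg1201LRFBCorner 2) + (-21/2 : ℝ) • levelDir) 2)
      (plusUps (emeryLine cuprateSigns (hg1201LRFBCorner 2) + (-21/2 : ℝ) • levelDir) 2)
      (plusNu (emeryLine cuprateSigns (hg1201LRFBCorner 2) + (-21/2 : ℝ) • levelDir) 2)) k := by
  intro k hk
  have h := kgp1x5_Hg1201LRFBx_c2_lh_mum105o10_table k hk
  rw [hg1201LRFBFloor_tau2, hg1201LRFBFloor_ups2, hg1201LRFBFloor_nu2] at h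
  exact h

/-- **Sector table, corner 3** (tilt `μ = -11`): the kernel table `kgp1x5_Hg1201LRFBx_c3_hh_mum110o10_table` in dictionary form, `θ = emeryLine cuprateSigns (hg1201LRFBCorner 3) + (-11)·levelDir`.
[cite: KullEtAl2024, §5.3] -/
theorem hg1201LRFBFloor_table3 : ∀ k ≤ 10, ((kgp1x5_Hg1201LRFBx_c3_hh_mum110o10_sigma k : ℚ) : ℝ) ≤
    groundEnergy (hubbardOpenBoxGP 1 5 (plusTau (emeryLine cuprateSigns (hg1201LRFBCorner 3) + (-11 : ℝ) • levelDir) 2)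
      (plusUps (emeryLine cuprateSigns (hg1201LRFBCorner 3) + (-11 : ℝ) • levelDir) 2)
      (plusNu (emeryLine cuprateSigns (hg1201LRFBCorner 3) + (-11 : ℝ) • levelDir) 2)) k := by
  intro k hk
  have h := kgp1x5_Hg1201LRFBx_c3_hh_mum110o10_table k hk
  rw [hg1201LRFBFloor_tau3, hg1201LRFBFloor_ups3, hg1201LRFBFloor_nu3] at h
  exact h

/-! ## §2 Level εp = -99/10: re-tilted certificates and the re-tilted flat cap word -/

/-- **Re-tilted certificate, corner 0 at level -99/10** (from tilt `-99/10`, `c = 0`; binding sector `k = 8`):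
`H^(w_2)_(W₅)[emeryInteraction (θ_0 + (-99/10)·levelDir)] + 0 − (-848201/10000)·1 ⪰ 0` (slope `−q₀′/2 = 42.4100`). [cite: KullEtAl2024, §5.3] [cite: ValentiStolzeHirschfeld1991, §II] -/
theorem hg1201LRFBRetilt_hq_m99o10_c0 :
    ((⟨fun X => (uniformPeriodicWeight liebPeriods emeryCuO4Window 2 X : ℂ) •
        (emeryInteraction (emeryLine cuprateSigns (hg1201LRFBCorner 0) + ((-99/10 : ℚ) : ℝ) • levelDir)).Φ X⟩ : FermionInteraction 2).localHamiltonian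
        emeryCuO4Window + (0 : FermionOp emeryCuO4Window) - ((-848201/10000 : ℝ) : ℂ) • (1 : FermionOp emeryCuO4Window)).PosSemidef := by
  have h := posSemidef_cuO4_uniform_retilt_of_sectorFloors (emeryLine cuprateSigns (hg1201LRFBCorner 0) + (-99/10 : ℝ) • levelDir) 2 (0 : ℝ)
    (σ := fun k => ((kgp1x5_Hg1201LRFBx_c0_ll_mum99o10_sigma k : ℚ) : ℝ)) hg1201LRFBFloor_table0 (q := (-848201/10000 : ℝ)) (fun k hk => by
      interval_cases k <;> norm_num [kgp1x5_Hg1201LRFBx_c0_ll_mum99o10_sigma, max_def, min_def])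
  rw [tilt_add_retilt, show (-99/10 : ℝ) + 0 = ((-99/10 : ℚ) : ℝ) by norm_num] at h
  exact h

/-- **Re-tilted certificate, corner 1 at level -99/10** (from tilt `-52/5`, `c = 1/2`; binding sector `k = 8`):
`H^(w_2)_(W₅)[emeryInteraction (θ_1 + (-99/10)·levelDir)] + 0 − (-43451/500)·1 ⪰ 0` (slope `−q₀′/2 = 43.4510`). [cite: KullEtAl2024, §5.3] [cite: ValentiStolzeHirschfeld1991, §II] -/
theorem hg1201LRFBRetilt_hq_m99o10_c1 :
    ((⟨fun X => (uniformPeriodicWeight liebPeriods emeryCuO4Window 2 X : ℂ) •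
        (emeryInteraction (emeryLine cuprateSigns (hg1201LRFBCorner 1) + ((-99/10 : ℚ) : ℝ) • levelDir)).Φ X⟩ : FermionInteraction 2).localHamiltonian
        emeryCuO4Window + (0 : FermionOp emeryCuO4Window) - ((-43451/500 : ℝ) : ℂ) • (1 : FermionOp emeryCuO4Window)).PosSemidef := by
  have h := posSemidef_cuO4_uniform_retilt_of_sectorFloors (emeryLine cuprateSigns (hg1201LRFBCorner 1) + (-52/5 : ℝ) • levelDir) 2 (1/2 : ℝ)
    (σ := fun k => ((kgp1x5_Hg1201LRFBx_c1_hl_mum104o10_sigma k : ℚ) : ℝ)) hg1201LRFBFloor_table1 (q := (-43451/500 : ℝ)) (fun k hk => by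
      interval_cases k <;> norm_num [kgp1x5_Hg1201LRFBx_c1_hl_mum104o10_sigma, max_def, min_def])
  rw [tilt_add_retilt, show (-52/5 : ℝ) + 1/2 = ((-99/10 : ℚ) : ℝ) by norm_num] at h
  exact h

/-- **Re-tilted certificate, corner 2 at level -99/10** (from tilt `-21/2`, `c = 3/5`; binding sector `k = 8`):
`H^(w_2)_(W₅)[emeryInteraction (θ_2 + (-99/10)·levelDir)] + 0 − (-3476773/40000)·1 ⪰ 0` (slope `−q₀′/2 = 43.4597`). [cite: KullEtAl2024, §5.3] [cite: ValentiStolzeHirschfeld1991, §II] -/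
theorem hg1201LRFBRetilt_hq_m99o10_c2 :
    ((⟨fun X => (uniformPeriodicWeight liebPeriods emeryCuO4Window 2 X : ℂ) •
        (emeryInteraction (emeryLine cuprateSigns (hg1201LRFBCorner 2) + ((-99/10 : ℚ) : ℝ) • levelDir)).Φ X⟩ : FermionInteraction 2).localHamiltonian
        emeryCuO4Window + (0 : FermionOp emeryCuO4Window) - ((-3476773/40000 : ℝ) : ℂ) • (1 : FermionOp emeryCuO4Window)).PosSemidef := by
  have h := posSemidef_cuO4_uniform_retilt_of_sectorFloors (emeryLine cuprateSigns (hg1201LRFBCorner 2) + (-21/2 : ℝ) • levelDir) 2 (3/5 : ℝ)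
    (σ := fun k => ((kgp1x5_Hg1201LRFBx_c2_lh_mum105o10_sigma k : ℚ) : ℝ)) hg1201LRFBFloor_table2 (q := (-3476773/40000 : ℝ)) (fun k hk => by
      interval_cases k <;> norm_num [kgp1x5_Hg1201LRFBx_c2_lh_mum105o10_sigma, max_def, min_def])
  rw [tilt_add_retilt, show (-21/2 : ℝ) + 3/5 = ((-99/10 : ℚ) : ℝ) by norm_num] at h
  exact h

/-- **Re-tilted certificate, corner 3 at level -99/10** (from tilt `-11`, `c = 11/10`; binding sector `k = 8`):
`H^(w_2)_(W₅)[emeryInteraction (θ_3 + (-99/10)·levelDir)] + 0 − (-284783/3200)·1 ⪰ 0` (slope `−q₀′/2 = 44.4973`). [cite: KullEtAl2024, §5.3] [cite: ValentiStolzeHirschfeld1991, §II] -/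
theorem hg1201LRFBRetilt_hq_m99o10_c3 :
    ((⟨fun X => (uniformPeriodicWeight liebPeriods emeryCuO4Window 2 X : ℂ) •
        (emeryInteraction (emeryLine cuprateSigns (hg1201LRFBCorner 3) + ((-99/10 : ℚ) : ℝ) • levelDir)).Φ X⟩ : FermionInteraction 2).localHamiltonian
        emeryCuO4Window + (0 : FermionOp emeryCuO4Window) - ((-284783/3200 : ℝ) : ℂ) • (1 : FermionOp emeryCuO4Window)).PosSemidef := by
  have h := posSemidef_cuO4_uniform_retilt_of_sectorFloors (emeryLine cuprateSigns (hg1201LRFBCorner 3) + (-11 : ℝ) • levelDir) 2 (11/10 : ℝ)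
    (σ := fun k => ((kgp1x5_Hg1201LRFBx_c3_hh_mum110o10_sigma k : ℚ) : ℝ)) hg1201LRFBFloor_table3 (q := (-284783/3200 : ℝ)) (fun k hk => by
      interval_cases k <;> norm_num [kgp1x5_Hg1201LRFBx_c3_hh_mum110o10_sigma, max_def, min_def])
  rw [tilt_add_retilt, show (-11 : ℝ) + 11/10 = ((-99/10 : ℚ) : ℝ) by norm_num] at h
  exact h


/-- **THE RE-TILTED CAP WORD at level εp = -99/10** (hypothesis-free, every β ≥ 0, every point of `emeryBoxHg1201LRFB`): `P_cell ≤ 6 log 2 + β·284783/6400`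
(`44.4973·β + 4.1589`) — versus `312943/6400 = 48.8973` by monotone transfer (`emeryBoxHg1201LRFB_pressureCap_m99o10`).
[cite: Israel1979, Thm. I.2.4] [cite: ValentiStolzeHirschfeld1991, §II] -/
theorem emeryBoxHg1201LRFB_pressureCap_m99o10_retilt {β : ℝ} (hβ : 0 ≤ β) :
    HoldsOn (fun p : EmeryCoord → ℝ =>
      emeryCellPressure β (emeryLine cuprateSigns (emeryLineCoords (((-99/10 : ℚ)) : ℝ) p)) ≤ 6 * Real.log 2 + β * (284783/6400 : ℝ)) emeryBoxHg1201LRFB :=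
  holdsOn_emeryCellPressureCap_of_tiltedCuO4Certificates (E := emeryBoxHg1201LRFB) (eA := hg1201Emery_tpd) (eB := hg1201Emery_tpp) (eD := hg1201LRFBEmery_Delta) (eUd := hg1201LRFBEmery_Udd) (eUp := hg1201LRFBEmery_Upp) (by simp [emeryBoxHg1201LRFB, emeryBoxHg1201LRFBSrc, Function.update]) (by simp [emeryBoxHg1201LRFB, emeryBoxHg1201LRFBSrc, Function.update]) (Function.update_self _ _ _) (by simp [emeryBoxHg1201LRFB, emeryBoxHg1201LRFBSrc, Function.update]) (by simp [emeryBoxHg1201LRFB, emeryBoxHg1201LRFBSrc, Function.update]) cuprateSigns hβ (M := 2) two_pos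
    (fun _ => 0) (fun _ ω' _ => re_expect_zero_cuO4 ω') (fun _ => (((-99/10 : ℚ)) : ℝ))
    (![-848201/10000, -43451/500, -3476773/40000, -284783/3200] : Fin 4 → ℝ)
    (fun i => by
      rw [hg1201LRFB_lowerCorner]
      fin_cases i
      · simpa using hg1201LRFBRetilt_hq_m99o10_c0
      · simpa using hg1201LRFBRetilt_hq_m99o10_c1
      · simpa using hg1201LRFBRetilt_hq_m99o10_c2
      · simpa using hg1201LRFBRetilt_hq_m99o10_c3)
    (fun _ => le_rfl) (fun i => by fin_cases i <;> simp <;> norm_num)  -- every re-tilted corner slope ≤ 284783/6400 (corner 3 binds)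

/-- **Grand-potential reading at level -99/10** (chemical potential `99/10` eV): for every `T > 0` and every point of the box,
`Ω/CuO₂ = −P_cell/β ≥ −284783/6400 − 6 log 2/β`. [cite: Israel1979, Thm. I.2.4] -/
theorem emeryBoxHg1201LRFB_grandPotential_ge_m99o10_retilt {β : ℝ} (hβ : 0 < β) :
    HoldsOn (fun p : EmeryCoord → ℝ =>
      -(284783/6400 : ℝ) - 6 * Real.log 2 / β ≤ -emeryCellPressure β (emeryLine cuprateSigns (emeryLineCoords (((-99/10 : ℚ)) : ℝ) p)) / β) emeryBoxHg1201LRFB :=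
  holdsOn_grandPotential_ge_of_pressureCap cuprateSigns hβ _ (emeryBoxHg1201LRFB_pressureCap_m99o10_retilt hβ.le)

/-! ## §3 The four sector tables re-tilted to the common level εp = -99/10, sector by sector -/

/-- **Corner 0, level -99/10** (from tilt `-99/10`, `c = 0`): `σ_0(k) + max(0·k + min(0, 2·0), 2·0·k − 4·max(0, 2·0)) ≤ E₀(h^G(θ_0 + (-99/10)·ε), k)`, `k ≤ 10`.
[cite: KullEtAl2024, §5.3] [cite: ValentiStolzeHirschfeld1991, §II] -/
theorem hg1201LRFBMarkovTable_m99o10_c0 : ∀ k ≤ 10,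
    ((kgp1x5_Hg1201LRFBx_c0_ll_mum99o10_sigma k : ℚ) : ℝ) + max ((0 : ℝ) * 2 / 2 * k + min 0 ((0 : ℝ) * 2)) ((0 : ℝ) * 2 * k - 4 * max 0 ((0 : ℝ) * 2)) ≤
      groundEnergy (hubbardOpenBoxGP 1 5 (plusTau (emeryLine cuprateSigns (hg1201LRFBCorner 0) + ((-99/10 : ℚ) : ℝ) • levelDir) 2)
        (plusUps (emeryLine cuprateSigns (hg1201LRFBCorner 0) + ((-99/10 : ℚ) : ℝ) • levelDir) 2)
        (plusNu (emeryLine cuprateSigns (hg1201LRFBCorner 0) + ((-99/10 : ℚ) : ℝ) • levelDir) 2)) k := by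
  have h := sectorFloors_plusGP_retilt (emeryLine cuprateSigns (hg1201LRFBCorner 0) + (-99/10 : ℝ) • levelDir) 2 (0 : ℝ) hg1201LRFBFloor_table0
  rw [tilt_add_retilt, show (-99/10 : ℝ) + 0 = ((-99/10 : ℚ) : ℝ) by norm_num] at h
  exact h

/-- **Corner 1, level -99/10** (from tilt `-52/5`, `c = 1/2`): `σ_1(k) + max(1/2·k + min(0, 2·1/2), 2·1/2·k − 4·max(0, 2·1/2)) ≤ E₀(h^G(θ_1 + (-99/10)·ε), k)`, `k ≤ 10`.
[cite: KullEtAl2024, §5.3] [cite: ValentiStolzeHirschfeld1991, §II] -/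
theorem hg1201LRFBMarkovTable_m99o10_c1 : ∀ k ≤ 10,
    ((kgp1x5_Hg1201LRFBx_c1_hl_mum104o10_sigma k : ℚ) : ℝ) + max ((1/2 : ℝ) * 2 / 2 * k + min 0 ((1/2 : ℝ) * 2)) ((1/2 : ℝ) * 2 * k - 4 * max 0 ((1/2 : ℝ) * 2)) ≤
      groundEnergy (hubbardOpenBoxGP 1 5 (plusTau (emeryLine cuprateSigns (hg1201LRFBCorner 1) + ((-99/10 : ℚ) : ℝ) • levelDir) 2)
        (plusUps (emeryLine cuprateSigns (hg1201LRFBCorner 1) + ((-99/10 : ℚ) : ℝ) • levelDir) 2)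
        (plusNu (emeryLine cuprateSigns (hg1201LRFBCorner 1) + ((-99/10 : ℚ) : ℝ) • levelDir) 2)) k := by
  have h := sectorFloors_plusGP_retilt (emeryLine cuprateSigns (hg1201LRFBCorner 1) + (-52/5 : ℝ) • levelDir) 2 (1/2 : ℝ) hg1201LRFBFloor_table1
  rw [tilt_add_retilt, show (-52/5 : ℝ) + 1/2 = ((-99/10 : ℚ) : ℝ) by norm_num] at h
  exact h

/-- **Corner 2, level -99/10** (from tilt `-21/2`, `c = 3/5`): `σ_2(k) + max(3/5·k + min(0, 2·3/5), 2·3/5·k − 4·max(0, 2·3/5)) ≤ E₀(h^G(θ_2 + (-99/10)·ε), k)`, `k ≤ 10`.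
[cite: KullEtAl2024, §5.3] [cite: ValentiStolzeHirschfeld1991, §II] -/
theorem hg1201LRFBMarkovTable_m99o10_c2 : ∀ k ≤ 10,
    ((kgp1x5_Hg1201LRFBx_c2_lh_mum105o10_sigma k : ℚ) : ℝ) + max ((3/5 : ℝ) * 2 / 2 * k + min 0 ((3/5 : ℝ) * 2)) ((3/5 : ℝ) * 2 * k - 4 * max 0 ((3/5 : ℝ) * 2)) ≤
      groundEnergy (hubbardOpenBoxGP 1 5 (plusTau (emeryLine cuprateSigns (hg1201LRFBCorner 2) + ((-99/10 : ℚ) : ℝ) • levelDir) 2)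
        (plusUps (emeryLine cuprateSigns (hg1201LRFBCorner 2) + ((-99/10 : ℚ) : ℝ) • levelDir) 2)
        (plusNu (emeryLine cuprateSigns (hg1201LRFBCorner 2) + ((-99/10 : ℚ) : ℝ) • levelDir) 2)) k := by
  have h := sectorFloors_plusGP_retilt (emeryLine cuprateSigns (hg1201LRFBCorner 2) + (-21/2 : ℝ) • levelDir) 2 (3/5 : ℝ) hg1201LRFBFloor_table2
  rw [tilt_add_retilt, show (-21/2 : ℝ) + 3/5 = ((-99/10 : ℚ) : ℝ) by norm_num] at h
  exact h

/-- **Corner 3, level -99/10** (from tilt `-11`, `c = 11/10`): `σ_3(k) + max(11/10·k + min(0, 2·11/10), 2·11/10·k − 4·max(0, 2·11/10)) ≤ E₀(h^G(θ_3 + (-99/10)·ε), k)`, `k ≤ 10`.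
[cite: KullEtAl2024, §5.3] [cite: ValentiStolzeHirschfeld1991, §II] -/
theorem hg1201LRFBMarkovTable_m99o10_c3 : ∀ k ≤ 10,
    ((kgp1x5_Hg1201LRFBx_c3_hh_mum110o10_sigma k : ℚ) : ℝ) + max ((11/10 : ℝ) * 2 / 2 * k + min 0 ((11/10 : ℝ) * 2)) ((11/10 : ℝ) * 2 * k - 4 * max 0 ((11/10 : ℝ) * 2)) ≤
      groundEnergy (hubbardOpenBoxGP 1 5 (plusTau (emeryLine cuprateSigns (hg1201LRFBCorner 3) + ((-99/10 : ℚ) : ℝ) • levelDir) 2)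
        (plusUps (emeryLine cuprateSigns (hg1201LRFBCorner 3) + ((-99/10 : ℚ) : ℝ) • levelDir) 2)
        (plusNu (emeryLine cuprateSigns (hg1201LRFBCorner 3) + ((-99/10 : ℚ) : ℝ) • levelDir) 2)) k := by
  have h := sectorFloors_plusGP_retilt (emeryLine cuprateSigns (hg1201LRFBCorner 3) + (-11 : ℝ) • levelDir) 2 (11/10 : ℝ) hg1201LRFBFloor_table3
  rw [tilt_add_retilt, show (-11 : ℝ) + 11/10 = ((-99/10 : ℚ) : ℝ) by norm_num] at h
  exact h

/-! ## §4 The four entropy-resolved corner caps at level εp = -99/10 -/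

/-- **CORNER 0, entropy-resolved cap** at level -99/10 (every β ≥ 0): `P_cell ≤ log max_{n≤4} Σ_{j≤6} C(6,j)·e^{−(β/2)·q_0(j+n)}`, `q_0(k) = σ_0(k) + max(0·k + min(0,2·0), 2·0·k − 4·max(0,2·0))`
(as β → ∞: `42.4100·β + log 15`, minimum in sector(s) k = [8]). [cite: PoulinHastings2011, eqs. (3)–(8)] [cite: Israel1979, Thm. I.2.4] -/
theorem emeryBoxHg1201LRFB_corner0_pressureCap_m99o10_markov {β : ℝ} (hβ : 0 ≤ β) :
    emeryCellPressure β (emeryLine cuprateSigns (hg1201LRFBCorner 0) + ((-99/10 : ℚ) : ℝ) • levelDir) ≤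
      Real.log ((Finset.range 5).sup' ⟨0, by simp⟩ fun n => ∑ j ∈ Finset.range 7, ((Nat.choose 6 j : ℕ) : ℝ) *
        Real.exp (-(β / 2 * (((kgp1x5_Hg1201LRFBx_c0_ll_mum99o10_sigma (j + n) : ℚ) : ℝ) +
          max ((0 : ℝ) * 2 / 2 * (j + n : ℕ) + min 0 ((0 : ℝ) * 2)) ((0 : ℝ) * 2 * (j + n : ℕ) - 4 * max 0 ((0 : ℝ) * 2)))))) := by
  refine emeryCellPressure_le_log_of_gpSectorFloors _ (M := 2) two_pos hβ _ hg1201LRFBMarkovTable_m99o10_c0 ?_ fun n hn => ?_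
  · exact lt_of_lt_of_le (sum_choose_exp_pos' _) (Finset.le_sup' (fun n => ∑ j ∈ Finset.range 7, ((Nat.choose 6 j : ℕ) : ℝ) *
        Real.exp (-(β / 2 * (((kgp1x5_Hg1201LRFBx_c0_ll_mum99o10_sigma (j + n) : ℚ) : ℝ) +
          max ((0 : ℝ) * 2 / 2 * (j + n : ℕ) + min 0 ((0 : ℝ) * 2)) ((0 : ℝ) * 2 * (j + n : ℕ) - 4 * max 0 ((0 : ℝ) * 2)))))) (Finset.mem_range.2 (by norm_num : 0 < 5)))
  · exact Finset.le_sup' (fun n => ∑ j ∈ Finset.range 7, ((Nat.choose 6 j : ℕ) : ℝ) *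
        Real.exp (-(β / 2 * (((kgp1x5_Hg1201LRFBx_c0_ll_mum99o10_sigma (j + n) : ℚ) : ℝ) +
          max ((0 : ℝ) * 2 / 2 * (j + n : ℕ) + min 0 ((0 : ℝ) * 2)) ((0 : ℝ) * 2 * (j + n : ℕ) - 4 * max 0 ((0 : ℝ) * 2)))))) (Finset.mem_range.2 (by omega))

/-- **CORNER 1, entropy-resolved cap** at level -99/10 (every β ≥ 0): `P_cell ≤ log max_{n≤4} Σ_{j≤6} C(6,j)·e^{−(β/2)·q_1(j+n)}`, `q_1(k) = σ_1(k) + max(1/2·k + min(0,2·1/2), 2·1/2·k − 4·max(0,2·1/2))`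
(as β → ∞: `43.4510·β + log 15`, minimum in sector(s) k = [8]). [cite: PoulinHastings2011, eqs. (3)–(8)] [cite: Israel1979, Thm. I.2.4] -/
theorem emeryBoxHg1201LRFB_corner1_pressureCap_m99o10_markov {β : ℝ} (hβ : 0 ≤ β) :
    emeryCellPressure β (emeryLine cuprateSigns (hg1201LRFBCorner 1) + ((-99/10 : ℚ) : ℝ) • levelDir) ≤
      Real.log ((Finset.range 5).sup' ⟨0, by simp⟩ fun n => ∑ j ∈ Finset.range 7, ((Nat.choose 6 j : ℕ) : ℝ) *
        Real.exp (-(β / 2 * (((kgp1x5_Hg1201LRFBx_c1_hl_mum104o10_sigma (j + n) : ℚ) : ℝ) +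
          max ((1/2 : ℝ) * 2 / 2 * (j + n : ℕ) + min 0 ((1/2 : ℝ) * 2)) ((1/2 : ℝ) * 2 * (j + n : ℕ) - 4 * max 0 ((1/2 : ℝ) * 2)))))) := by
  refine emeryCellPressure_le_log_of_gpSectorFloors _ (M := 2) two_pos hβ _ hg1201LRFBMarkovTable_m99o10_c1 ?_ fun n hn => ?_
  · exact lt_of_lt_of_le (sum_choose_exp_pos' _) (Finset.le_sup' (fun n => ∑ j ∈ Finset.range 7, ((Nat.choose 6 j : ℕ) : ℝ) *
        Real.exp (-(β / 2 * (((kgp1x5_Hg1201LRFBx_c1_hl_mum104o10_sigma (j + n) : ℚ) : ℝ) +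
          max ((1/2 : ℝ) * 2 / 2 * (j + n : ℕ) + min 0 ((1/2 : ℝ) * 2)) ((1/2 : ℝ) * 2 * (j + n : ℕ) - 4 * max 0 ((1/2 : ℝ) * 2)))))) (Finset.mem_range.2 (by norm_num : 0 < 5)))
  · exact Finset.le_sup' (fun n => ∑ j ∈ Finset.range 7, ((Nat.choose 6 j : ℕ) : ℝ) *
        Real.exp (-(β / 2 * (((kgp1x5_Hg1201LRFBx_c1_hl_mum104o10_sigma (j + n) : ℚ) : ℝ) +
          max ((1/2 : ℝ) * 2 / 2 * (j + n : ℕ) + min 0 ((1/2 : ℝ) * 2)) ((1/2 : ℝ) * 2 * (j + n : ℕ) - 4 * max 0 ((1/2 : ℝ) * 2)))))) (Finset.mem_range.2 (by omega))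

/-- **CORNER 2, entropy-resolved cap** at level -99/10 (every β ≥ 0): `P_cell ≤ log max_{n≤4} Σ_{j≤6} C(6,j)·e^{−(β/2)·q_2(j+n)}`, `q_2(k) = σ_2(k) + max(3/5·k + min(0,2·3/5), 2·3/5·k − 4·max(0,2·3/5))`
(as β → ∞: `43.4597·β + log 15`, minimum in sector(s) k = [8]). [cite: PoulinHastings2011, eqs. (3)–(8)] [cite: Israel1979, Thm. I.2.4] -/
theorem emeryBoxHg1201LRFB_corner2_pressureCap_m99o10_markov {β : ℝ} (hβ : 0 ≤ β) :
    emeryCellPressure β (emeryLine cuprateSigns (hg1201LRFBCorner 2) + ((-99/10 : ℚ) : ℝ) • levelDir) ≤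
      Real.log ((Finset.range 5).sup' ⟨0, by simp⟩ fun n => ∑ j ∈ Finset.range 7, ((Nat.choose 6 j : ℕ) : ℝ) *
        Real.exp (-(β / 2 * (((kgp1x5_Hg1201LRFBx_c2_lh_mum105o10_sigma (j + n) : ℚ) : ℝ) +
          max ((3/5 : ℝ) * 2 / 2 * (j + n : ℕ) + min 0 ((3/5 : ℝ) * 2)) ((3/5 : ℝ) * 2 * (j + n : ℕ) - 4 * max 0 ((3/5 : ℝ) * 2)))))) := by
  refine emeryCellPressure_le_log_of_gpSectorFloors _ (M := 2) two_pos hβ _ hg1201LRFBMarkovTable_m99o10_c2 ?_ fun n hn => ?_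
  · exact lt_of_lt_of_le (sum_choose_exp_pos' _) (Finset.le_sup' (fun n => ∑ j ∈ Finset.range 7, ((Nat.choose 6 j : ℕ) : ℝ) *
        Real.exp (-(β / 2 * (((kgp1x5_Hg1201LRFBx_c2_lh_mum105o10_sigma (j + n) : ℚ) : ℝ) +
          max ((3/5 : ℝ) * 2 / 2 * (j + n : ℕ) + min 0 ((3/5 : ℝ) * 2)) ((3/5 : ℝ) * 2 * (j + n : ℕ) - 4 * max 0 ((3/5 : ℝ) * 2)))))) (Finset.mem_range.2 (by norm_num : 0 < 5)))
  · exact Finset.le_sup' (fun n => ∑ j ∈ Finset.range 7, ((Nat.choose 6 j : ℕ) : ℝ) *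
        Real.exp (-(β / 2 * (((kgp1x5_Hg1201LRFBx_c2_lh_mum105o10_sigma (j + n) : ℚ) : ℝ) +
          max ((3/5 : ℝ) * 2 / 2 * (j + n : ℕ) + min 0 ((3/5 : ℝ) * 2)) ((3/5 : ℝ) * 2 * (j + n : ℕ) - 4 * max 0 ((3/5 : ℝ) * 2)))))) (Finset.mem_range.2 (by omega))

/-- **CORNER 3, entropy-resolved cap** at level -99/10 (every β ≥ 0): `P_cell ≤ log max_{n≤4} Σ_{j≤6} C(6,j)·e^{−(β/2)·q_3(j+n)}`, `q_3(k) = σ_3(k) + max(11/10·k + min(0,2·11/10), 2·11/10·k − 4·max(0,2·11/10))`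
(as β → ∞: `44.4973·β + log 15`, minimum in sector(s) k = [8]). [cite: PoulinHastings2011, eqs. (3)–(8)] [cite: Israel1979, Thm. I.2.4] -/
theorem emeryBoxHg1201LRFB_corner3_pressureCap_m99o10_markov {β : ℝ} (hβ : 0 ≤ β) :
    emeryCellPressure β (emeryLine cuprateSigns (hg1201LRFBCorner 3) + ((-99/10 : ℚ) : ℝ) • levelDir) ≤
      Real.log ((Finset.range 5).sup' ⟨0, by simp⟩ fun n => ∑ j ∈ Finset.range 7, ((Nat.choose 6 j : ℕ) : ℝ) *
        Real.exp (-(β / 2 * (((kgp1x5_Hg1201LRFBx_c3_hh_mum110o10_sigma (j + n) : ℚ) : ℝ) +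
          max ((11/10 : ℝ) * 2 / 2 * (j + n : ℕ) + min 0 ((11/10 : ℝ) * 2)) ((11/10 : ℝ) * 2 * (j + n : ℕ) - 4 * max 0 ((11/10 : ℝ) * 2)))))) := by
  refine emeryCellPressure_le_log_of_gpSectorFloors _ (M := 2) two_pos hβ _ hg1201LRFBMarkovTable_m99o10_c3 ?_ fun n hn => ?_
  · exact lt_of_lt_of_le (sum_choose_exp_pos' _) (Finset.le_sup' (fun n => ∑ j ∈ Finset.range 7, ((Nat.choose 6 j : ℕ) : ℝ) *
        Real.exp (-(β / 2 * (((kgp1x5_Hg1201LRFBx_c3_hh_mum110o10_sigma (j + n) : ℚ) : ℝ) +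
          max ((11/10 : ℝ) * 2 / 2 * (j + n : ℕ) + min 0 ((11/10 : ℝ) * 2)) ((11/10 : ℝ) * 2 * (j + n : ℕ) - 4 * max 0 ((11/10 : ℝ) * 2)))))) (Finset.mem_range.2 (by norm_num : 0 < 5)))
  · exact Finset.le_sup' (fun n => ∑ j ∈ Finset.range 7, ((Nat.choose 6 j : ℕ) : ℝ) *
        Real.exp (-(β / 2 * (((kgp1x5_Hg1201LRFBx_c3_hh_mum110o10_sigma (j + n) : ℚ) : ℝ) +
          max ((11/10 : ℝ) * 2 / 2 * (j + n : ℕ) + min 0 ((11/10 : ℝ) * 2)) ((11/10 : ℝ) * 2 * (j + n : ℕ) - 4 * max 0 ((11/10 : ℝ) * 2)))))) (Finset.mem_range.2 (by omega))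

/-! ## §5 The entropy-resolved box word -/

/-- **THE ENTROPY-RESOLVED `T > 0` CAP WORD on `emeryBoxHg1201LRFB`** (hypothesis-free, every β ≥ 0, every point, level εp = -99/10 ⇔ chemical potential `99/10` eV):
`P_cell(β) ≤ maxᵢ log Fᵢ(β)` with the four corner functions of §4 [as β → ∞: `44.4973·β + log 15` = `44.4973·β + 2.7081`; float table in the module
docstring] versus the flat re-tilted word `44.4973·β + 4.1589` of `emeryBoxHg1201LRFB_pressureCap_m99o10_retilt`. [cite: Israel1979, Thm. I.3.4] [cite: PoulinHastings2011, eqs. (3)–(8)] -/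
theorem emeryBoxHg1201LRFB_pressureCap_m99o10_markov {β : ℝ} (hβ : 0 ≤ β) :
    HoldsOn (fun p : EmeryCoord → ℝ =>
      emeryCellPressure β (emeryLine cuprateSigns (emeryLineCoords (((-99/10 : ℚ)) : ℝ) p)) ≤
        max (max
          (Real.log ((Finset.range 5).sup' ⟨0, by simp⟩ fun n => ∑ j ∈ Finset.range 7, ((Nat.choose 6 j : ℕ) : ℝ) *
        Real.exp (-(β / 2 * (((kgp1x5_Hg1201LRFBx_c0_ll_mum99o10_sigma (j + n) : ℚ) : ℝ) +
          max ((0 : ℝ) * 2 / 2 * (j + n : ℕ) + min 0 ((0 : ℝ) * 2)) ((0 : ℝ) * 2 * (j + n : ℕ) - 4 * max 0 ((0 : ℝ) * 2)))))))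
          (Real.log ((Finset.range 5).sup' ⟨0, by simp⟩ fun n => ∑ j ∈ Finset.range 7, ((Nat.choose 6 j : ℕ) : ℝ) *
        Real.exp (-(β / 2 * (((kgp1x5_Hg1201LRFBx_c1_hl_mum104o10_sigma (j + n) : ℚ) : ℝ) +
          max ((1/2 : ℝ) * 2 / 2 * (j + n : ℕ) + min 0 ((1/2 : ℝ) * 2)) ((1/2 : ℝ) * 2 * (j + n : ℕ) - 4 * max 0 ((1/2 : ℝ) * 2))))))))
          (max
          (Real.log ((Finset.range 5).sup' ⟨0, by simp⟩ fun n => ∑ j ∈ Finset.range 7, ((Nat.choose 6 j : ℕ) : ℝ) *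
        Real.exp (-(β / 2 * (((kgp1x5_Hg1201LRFBx_c2_lh_mum105o10_sigma (j + n) : ℚ) : ℝ) +
          max ((3/5 : ℝ) * 2 / 2 * (j + n : ℕ) + min 0 ((3/5 : ℝ) * 2)) ((3/5 : ℝ) * 2 * (j + n : ℕ) - 4 * max 0 ((3/5 : ℝ) * 2)))))))
          (Real.log ((Finset.range 5).sup' ⟨0, by simp⟩ fun n => ∑ j ∈ Finset.range 7, ((Nat.choose 6 j : ℕ) : ℝ) *
        Real.exp (-(β / 2 * (((kgp1x5_Hg1201LRFBx_c3_hh_mum110o10_sigma (j + n) : ℚ) : ℝ) +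
          max ((11/10 : ℝ) * 2 / 2 * (j + n : ℕ) + min 0 ((11/10 : ℝ) * 2)) ((11/10 : ℝ) * 2 * (j + n : ℕ) - 4 * max 0 ((11/10 : ℝ) * 2)))))))))
      emeryBoxHg1201LRFB := by
  refine holdsOn_emeryCellPressureCap_of_cornerCaps (E := emeryBoxHg1201LRFB) (eA := hg1201Emery_tpd) (eB := hg1201Emery_tpp) (eD := hg1201LRFBEmery_Delta) (eUd := hg1201LRFBEmery_Udd) (eUp := hg1201LRFBEmery_Upp) (by simp [emeryBoxHg1201LRFB, emeryBoxHg1201LRFBSrc, Function.update]) (by simp [emeryBoxHg1201LRFB, emeryBoxHg1201LRFBSrc, Function.update]) (Function.update_self _ _ _) (by simp [emeryBoxHg1201LRFB, emeryBoxHg1201LRFBSrc, Function.update]) (by simp [emeryBoxHg1201LRFB, emeryBoxHg1201LRFBSrc, Function.update]) cuprateSigns hβ fun i => ?_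
  rw [emeryLine_lowerCorner_level, hg1201LRFB_lowerCorner]
  fin_cases i
  · exact le_max_of_le_left (le_max_of_le_left (emeryBoxHg1201LRFB_corner0_pressureCap_m99o10_markov hβ))
  · exact le_max_of_le_left (le_max_of_le_right (emeryBoxHg1201LRFB_corner1_pressureCap_m99o10_markov hβ))
  · exact le_max_of_le_right (le_max_of_le_left (emeryBoxHg1201LRFB_corner2_pressureCap_m99o10_markov hβ))
  · exact le_max_of_le_right (le_max_of_le_right (emeryBoxHg1201LRFB_corner3_pressureCap_m99o10_markov hβ))

end Summit.Ventures.CertifiedManyBodySolver.Downfold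

end
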